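import Summits.QuantumFields.YangMills.Theorems.BalabanUVNodesN11NodeFacesOfSupplyChainTokensOperandRoads
import Literature.MathematicalPhysics.QuantumFieldTheory.Balaban1983to89.Node00.N24ItemsStage13AtThm1CCMWZSepCoPH

/-!
# DAG node N11 — THE K1 DOOR AT THE CERTIFICATE OF THE z-WITNESS `θᴳᶻ := gaussPinH (Stage13HParams.ofHistoryBlind F N ⟨θ₁₅ᶜᶜᴹᵂᶻ(j; γ; Efl, logz), Zr⟩)`: the `rfl` faces,
# K⁰'s ANTECEDENT ∕ the FOUR DOOR ROWS (`Provisos₁₃SepCoPH`, `Admissible`, `ZhUnity ∧ SlotsNondegenerate₁₃`, the (R₁₃) law chain) and N11's ALL-RUNS `hT` ∕ `h11` TYPE there —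
# the Z edition of dag-n11-w6 g0's `…N11K1WitnessGaussPinH` (X6), so that a K1 closer keyed at `θᴳᶻ` (where N11's no-expansion half is dischargeable) has every row BY NAME

HEADER — WORK-UNIT METADATA.  Cell `pub-ymgap`, YM-PLAN Track A (HUMAN RULING D-0062 ∕ D-0149 width seats), seat `pub-ymgap-dag-n11-w1` (g5; WIDTH SEAT 1 of 4 on NODE
n11 [B14]), route `BalabanUVNodes` rev 29, KEY item K1⁹ `StabilityBRunRowsAtRecordR13SepCoPHV` = stmt-QuantumFields-27364 (dag-lead KEY MAP v2; helper lane, `--kind proof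
--supports 27364 --as helper`, count-neutral; seat payload key K1⁷ 20542 = MIS-KEY fallback).  [III] = [Balaban1988Convergent], [V] = [Balaban1989LargeFieldII], [IV] =
[Balaban1989LargeFieldI], [I] = [Balaban1987RG1], [15] = [Balaban1985Variational].  Over dag-n11-w6 g0's `…N11K1WitnessGaussPinH` (the BLIND edition; OFFER-1 I.39748: first refusal
theirs), this seat's `…GaussianCertificateDefs` (`gaussPinH`, `antecedent_gaussPinH`, `provisos₁₃CoPH_gaussPinH`, `gaussPinH_ζ0`), `…GaussianCertificateRows` (`zhUnity_of_gaussCert`),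
`…Sect3SupplyChainNodeAtNumerics` (θ-generic `thmP245Laws_all_liveRepinH_of_supplyChainAt`, `sLaw₁₃CoPH_all_liveRepinH_gaussCert_of_obligations_of_operandRows`), dag-n11-e's
`…ObligationsDefs` (`noExpansionObligation_of_gaussCert_of_operandRows`), ym-nodeO DEF-1 g9's Z2 `Node00/Record13NumericsOfThm1CCMZ` (`theta13OfThm1CCMWZ`, `theta13OfNumericsZ`,
`admissible_theta13OfNumericsZ`, `admissible_theta13OfThm1CCMWZ_of_le_half`, `slotsNondegenerate₁₃_theta13OfThm1CCMWZ`) and dag-n24-c g12's Z door `Node00/N24ItemsStage13AtThm1CCMWZSepCoPH`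
(`N24_provisos₁₃SepCoPH_door_theta13OfThm1CCMWZ_of_gauge9TopStepR_of_betaBoxSignFree_allTorus`, free-slot `N24_rOpLeaf_VOfRecord₁₃CoPH_theta13OfThm1CCMWZ` ∕ `N24_laws₁₃CoPH_theta13OfThm1CCMWZ`).

WHY THIS FILE.  FLAG №9 ∕ director-ym №218: the K1 closers are re-keyed at the z-witness `θ₁₅ᶜᶜᴹᵂᶻ(j; γ; Efl, logz)`; dag-n24-c's Z closers (`…AtThm1CCMWZDoorOfChildrenSlotLetter`) key NODE N11
at the BARE history-blind extension `θᴴᶻ = ofHistoryBlind ⟨θ₁₅ᶜᶜᴹᵂᶻ, ZrOfRecord₁₃ θ₁₅ᶜᶜᴹᵂᶻ⟩`.  dag-n11-e g19's LOCATED-ZH (typed in dag-n11-w5's `…N11H11TypeOfSupplyChain` header): at a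
history-blind residual slot the `NoExpansionObligation` half of N11's token `SupplyChainAt θᴴ P` is dischargeable by NO N11 lane (dag-n11-d `not_exists_historyBlind_pointwise_pin`); it IS
dischargeable at this seat's certificate `gaussPinH θᴴ` (def-T's operand rows alone, `noExpansionObligation_of_gaussCert_of_operandRows`).  dag-n11-w6 g0 therefore typed the four door
rows + N11's side at `θᴳ = gaussPinH θᴴ` of the BLIND witness «so that dag-n24-c can switch `θᴴ ↦ θᴳ` BY NAME».  THIS FILE is that file's Z edition — every proof ONE application of a
θ-generic core (this seat's `antecedent_gaussPinH` ∕ `zhUnity_of_gaussCert`, Z2's rows, dag-n24-c's free-slot Z rows read at `θᴳᶻ`'s own slots — `θᴳᶻ` IS the tuple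
`⟨⟨θ₁₅ᶜᶜᴹᵂᶻ, Zr⟩, θᴳᶻ.Zh, θᴳᶻ.Phih⟩`, `rfl`) — plus N11's ALL-RUNS `hT` ∕ `h11` type at `θᴳᶻ` from `hrec` + supplier obligations + operand rows (dag-n11-w6 §2's shapes; the WINDOWED
editions are this seat's `…TokensAtZWitness` §3).  The letters `Efl`, `logz` are NOT read anywhere (window `0 < γ ≤ ½` + six signs only).

WHAT THIS FILE PROVES (17 theorems, 0 `def`, 0 `sorry`; standard axioms; compositions BY NAME + `rfl`).
§0 faces (`rfl`): `gaussPinH_ofHistoryBlind_theta13OfThm1CCMWZ_toStage13Params` · `…_toStage13RParams` · `betaOfRecord₁₃_gaussPinH_ofHistoryBlind_theta13OfThm1CCMWZ` · `gaussPinH_ofHistoryBlind_theta13OfThm1CCMWZ_eq_tuple`.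
§1 ★ `antecedent_gaussPinH_ofHistoryBlind_theta13OfThm1CCMWZ` (from ANY door proof at `θᴴᶻ`, general `Zr`) · ★★ `antecedent_gaussPinH_theta13OfThm1CCMWZ_of_gauge9TopStepR_of_betaBoxSignFree_allTorus_door`
   (keyed on dag-n24-c's Z door letters) · ★★ `provisos₁₃SepCoPH_gaussPinH_theta13OfThm1CCMWZ_door` · ★ `zhUnity_slotsNondegenerate₁₃_gaussPinH_ofHistoryBlind_theta13OfThm1CCMWZ` (UNCONDITIONAL) ·
   ★ `admissible_gaussPinH_ofHistoryBlind_theta13OfThm1CCMWZ`.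
§2 ★ `N13_rOpLeaf_VOfRecord₁₃CoPH_gaussPinH_ofHistoryBlind_theta13OfThm1CCMWZ` · ★ `N13_laws₁₃CoPH_gaussPinH_ofHistoryBlind_theta13OfThm1CCMWZ` · ★★ `N13_laws₁₃CoPH_all_…Z` (the `hlaws` door row).
§3 ★★ `hT_gaussPinH_ofHistoryBlind_theta13OfThm1CCMWZ_of_supplyChainAt` · ★★★ `hT_gaussPinH_ofHistoryBlind_theta13OfThm1CCMWZ_of_obligations_of_operandRows` ·
   ★★ `sLaw₁₃CoPH_all_gaussPinH_ofHistoryBlind_theta13OfThm1CCMWZ_of_obligations_of_operandRows` · `N11_h11_gaussPinH_ofHistoryBlind_theta13OfThm1CCMWZ_of_laws` ·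
   ★★★ `N11_h11_gaussPinH_ofHistoryBlind_theta13OfThm1CCMWZ_of_obligations_of_operandRows`.

HONEST FRAMING.  Helper lane of K1⁹; count-neutral KERNEL COMPOSITION at a DEFINITION EDITION; the door letters ((8) `VariationalThm1RegSepCoP7M`, floor `c ≤ L^j`, [15] Sect. F's R
(9)-step, the sign-free windowed β-box), `SupplierObligations` ([III] §3 ∕ Thm 2 proper — XL, nobody's theorem), def-T's operand rows, `hrec` are DISPLAYED HYPOTHESES; NO value of
`E_k ∕ log z_k` pinned or read; NOT a claim that `θᴳᶻ` (or `θ₁₅ᶜᶜᴹᵂᶻ`) is K1⁹'s witness; FLAG №9 NOT closed by this (№218 (4)); nothing of Bałaban asserted.  No v10 stub touched; K0⁷ ∕ K1⁹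
NOT closed; N11 ∕ N13 NOT discharged; counts unmoved (typed 28∕28 · discharged 5∕27 · A 5∕28).  One finite `𝕋⁴_{L^K}` programme at fixed `ε = L^{−K}`; R4 closes only the conditional
finite-𝕋⁴ rung `BalabanLadder.UV` — NOT ℝ⁴, NOT OS, NOT a mass gap, NOT Clay.  No `sorry`, `axiom`, `def`, `instance`, `notation`.
Sources (SHAPE ∕ bookkeeping only): [III] Thm 1 p.262, Theorem p.245, remark p.262, p.244, (1.11) p.248, (1.15) p.249, (2.6)–(2.8) pp.255–256, (2.21) p.258, (3.16)–(3.25) pp.268–270,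
§3 p.279; [V] Thm 1 + (0.1) pp.355–356, (0.15) p.360; [IV] (0.2)–(0.4) p.176, p.177 (i)–(ii); [I] Thm 1 pp.255∕259, (0.20) p.256, §1 p.264; [15] Thm 1 (8)–(9) p.279, Prop. 8 p.304.
-/

noncomputable section

open MeasureTheory
open scoped BigOperators ENNReal NNReal Matrix.Norms.L2Operator

namespace Summit.QuantumFields.YangMills.Theorems.BalabanUVNodesN11K1WitnessGaussPinHAtZ

open Literature.MathematicalPhysics.QuantumFieldTheory.Balaban1983to89 T4Continuum Node00 Node00.Tk DagBinding T4DatumAssembly FlowStepRuns AveragingRT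
open FlowStep (BetaLowerH BetaUpperH)
open B10Eq42TorusConstraint (bondsIn)
open BalabanUVNodesN11Sect3SupplyChainDefs (Sect3Supplier)
open BalabanUVNodesN11Sect3SupplyChainObligationsDefs
open BalabanUVNodesN11GaussianCertificateDefs (gaussPinH gaussPinH_ζ0 gaussPinH_quad provisos₁₃CoPH_gaussPinH antecedent_gaussPinH gaussPinH_toStage13Params)
open BalabanUVNodesN11GaussianCertificateRows (zhUnity_of_gaussCert)
open BalabanUVNodesN11Sect3SupplyChainNodeAtNumerics

variable {F : T4Family} {N : ℕ} [NeZero N]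

/-! ## §0  `rfl` faces of `θᴳᶻ := gaussPinH (Stage13HParams.ofHistoryBlind F N ⟨θ₁₅ᶜᶜᴹᵂᶻ, Zr⟩)` — the Stage-13 part is the z-witness `θ₁₅ᶜᶜᴹᵂᶻ(j; γ; Efl, logz)` itself -/

section Faces

variable (j : ℕ) (γ ε₀ ε₂₉ B₃ B₃' a₀ a₁ : ℝ) (Efl logz : B12.RunParams → ℕ → ℝ) (Zr : (q : B12.RunParams) → TkResidualW F N (FluctV N) q.K)

/-- The Stage-13 part of `θᴳᶻ` IS `θ₁₅ᶜᶜᴹᵂᶻ(j; γ; Efl, logz)` (`rfl`): every `θ₁₅ᶜᶜᴹᵂᶻ`-keyed numeric, leaf and β-of-record face of dag-n24-c's Z door is unchanged under `θᴴᶻ ↦ θᴳᶻ`.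
[cite: Balaban1988Convergent, (3.16) p.268, (1.15) p.249 (bookkeeping)] -/
theorem gaussPinH_ofHistoryBlind_theta13OfThm1CCMWZ_toStage13Params :
    (gaussPinH (Stage13HParams.ofHistoryBlind F N ⟨theta13OfThm1CCMWZ F N j γ ε₀ ε₂₉ B₃ B₃' a₀ a₁ Efl logz, Zr⟩)).toStage13Params =
      theta13OfThm1CCMWZ F N j γ ε₀ ε₂₉ B₃ B₃' a₀ a₁ Efl logz := rfl

/-- The Stage-13R part of `θᴳᶻ` is `⟨θ₁₅ᶜᶜᴹᵂᶻ, Zr⟩` (`rfl`). [cite: Balaban1988Convergent, (3.16) p.268 (bookkeeping)] -/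
theorem gaussPinH_ofHistoryBlind_theta13OfThm1CCMWZ_toStage13RParams :
    (gaussPinH (Stage13HParams.ofHistoryBlind F N ⟨theta13OfThm1CCMWZ F N j γ ε₀ ε₂₉ B₃ B₃' a₀ a₁ Efl logz, Zr⟩)).toStage13RParams =
      ⟨theta13OfThm1CCMWZ F N j γ ε₀ ε₂₉ B₃ B₃' a₀ a₁ Efl logz, Zr⟩ := rfl

/-- The β of record read by the K1 run rows ∕ box letters is unchanged under `θᴴᶻ ↦ θᴳᶻ` (`rfl`) — and it is the BLIND β (Z2 `betaOfRecord₁₃` is E-free).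
[cite: Balaban1987RG1, (1.20)–(1.22) p.264 (bookkeeping)] -/
theorem betaOfRecord₁₃_gaussPinH_ofHistoryBlind_theta13OfThm1CCMWZ :
    betaOfRecord₁₃ F N (gaussPinH (Stage13HParams.ofHistoryBlind F N ⟨theta13OfThm1CCMWZ F N j γ ε₀ ε₂₉ B₃ B₃' a₀ a₁ Efl logz, Zr⟩)).toStage13Params =
      betaOfRecord₁₃ F N (theta13OfThm1CCMWZ F N j γ ε₀ ε₂₉ B₃ B₃' a₀ a₁ Efl logz) := rfl

/-- `θᴳᶻ` IS the free-residual-slots tuple `⟨⟨θ₁₅ᶜᶜᴹᵂᶻ, Zr⟩, θᴳᶻ.Zh, θᴳᶻ.Phih⟩` (`rfl`), so every free-slot theorem of dag-n24-c's Z door §0 instantiates at `θᴳᶻ`.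
[cite: Balaban1988Convergent, (3.16)–(3.20) pp.268–269 (bookkeeping)] -/
theorem gaussPinH_ofHistoryBlind_theta13OfThm1CCMWZ_eq_tuple :
    gaussPinH (Stage13HParams.ofHistoryBlind F N ⟨theta13OfThm1CCMWZ F N j γ ε₀ ε₂₉ B₃ B₃' a₀ a₁ Efl logz, Zr⟩) =
      (⟨⟨theta13OfThm1CCMWZ F N j γ ε₀ ε₂₉ B₃ B₃' a₀ a₁ Efl logz, Zr⟩,
        (gaussPinH (Stage13HParams.ofHistoryBlind F N ⟨theta13OfThm1CCMWZ F N j γ ε₀ ε₂₉ B₃ B₃' a₀ a₁ Efl logz, Zr⟩)).Zh,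
        (gaussPinH (Stage13HParams.ofHistoryBlind F N ⟨theta13OfThm1CCMWZ F N j γ ε₀ ε₂₉ B₃ B₃' a₀ a₁ Efl logz, Zr⟩)).Phih⟩ : Stage13HParams F N) := rfl

end Faces

/-! ## §1  K⁰'s ANTECEDENT ∕ THE FOUR DOOR ROWS AT `θᴳᶻ`: from any door proof at `θᴴᶻ` (general `Zr`), and keyed on dag-n24-c's Z door letters (`Zr := ZrOfRecord₁₃ F N θ₁₅ᶜᶜᴹᵂᶻ`) -/

section Antecedent

variable {j : ℕ} {γ ε₀ ε₂₉ B₃ B₃' a₀ a₁ : ℝ} {Efl logz : B12.RunParams → ℕ → ℝ}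

/-- **★ K⁰'s ANTECEDENT AT `θᴳᶻ` FROM ANY DOOR PROOF AT `θᴴᶻ`** (general run-indexed residual `Zr`): `Provisos₁₃SepCoPH ∧ (ZhUnity ∧ SlotsNondegenerate₁₃) ∧ Admissible` at
`gaussPinH (ofHistoryBlind ⟨θ₁₅ᶜᶜᴹᵂᶻ, Zr⟩)` from `hP` (this seat's `antecedent_gaussPinH`: `ZhUnity` UNCONDITIONAL at the certificate; non-degeneracy and admissibility read the Stage-13
part only — Z2's `slotsNondegenerate₁₃_theta13OfThm1CCMWZ`, `admissible_theta13OfThm1CCMWZ_of_le_half` from the window `0 < γ ≤ ½` + six signs, WHATEVER THE LETTERS).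
[cite: Balaban1988Convergent, Thm 1 p.262, (2.6)–(2.8) pp.255–256, (3.16)–(3.22) pp.268–269, (1.15) p.249; Balaban1987RG1, Thm 1 p.259; Balaban1989LargeFieldII, (0.15) p.360; Balaban1989LargeFieldI, (0.2)–(0.4) p.176 (bookkeeping)] -/
theorem antecedent_gaussPinH_ofHistoryBlind_theta13OfThm1CCMWZ (hγ₀ : 0 < γ) (hγh : γ ≤ 1 / 2) (hε : 0 < ε₀) (hε' : 0 < ε₂₉) (hB : 0 ≤ B₃) (hB' : 0 ≤ B₃')
    (ha₀ : 0 < a₀) (ha₁ : 0 < a₁) (Zr : (q : B12.RunParams) → TkResidualW F N (FluctV N) q.K)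
    (hP : (Stage13HParams.ofHistoryBlind F N ⟨theta13OfThm1CCMWZ F N j γ ε₀ ε₂₉ B₃ B₃' a₀ a₁ Efl logz, Zr⟩).Provisos₁₃SepCoPH F N) :
    (gaussPinH (Stage13HParams.ofHistoryBlind F N ⟨theta13OfThm1CCMWZ F N j γ ε₀ ε₂₉ B₃ B₃' a₀ a₁ Efl logz, Zr⟩)).Provisos₁₃SepCoPH F N ∧
      ((gaussPinH (Stage13HParams.ofHistoryBlind F N ⟨theta13OfThm1CCMWZ F N j γ ε₀ ε₂₉ B₃ B₃' a₀ a₁ Efl logz, Zr⟩)).ZhUnity F N ∧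
        (gaussPinH (Stage13HParams.ofHistoryBlind F N ⟨theta13OfThm1CCMWZ F N j γ ε₀ ε₂₉ B₃ B₃' a₀ a₁ Efl logz, Zr⟩)).SlotsNondegenerate₁₃ F N) ∧
      (gaussPinH (Stage13HParams.ofHistoryBlind F N ⟨theta13OfThm1CCMWZ F N j γ ε₀ ε₂₉ B₃ B₃' a₀ a₁ Efl logz, Zr⟩)).Admissible F N :=
  antecedent_gaussPinH hP (slotsNondegenerate₁₃_theta13OfThm1CCMWZ F N j γ ε₀ ε₂₉ B₃ B₃' a₀ a₁ Efl logz)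
    (admissible_theta13OfThm1CCMWZ_of_le_half F N Efl logz hγ₀ hγh hε hε' hB hB' ha₀ ha₁)

/-- **★★ K⁰'s ANTECEDENT AT `θᴳᶻ` KEYED ON dag-n24-c's Z DOOR LETTERS** (the window `0 < γ ≤ ½`, the six signs, (8) `VariationalThm1RegSepCoP7M`, the floor `c ≤ L^j`, [15] Sect. F's
R (9)-step `Gauge9RegSepTopStepR`, the SIGN-FREE windowed β-box of `betaOfRecord₁₃ F N θ₁₅ᶜᶜᴹᵂᶻ` with letters `−bₗ·γ² ≤ 3`, `β'·γ² ≤ ¾`) at `Zr := ZrOfRecord₁₃ F N θ₁₅ᶜᶜᴹᵂᶻ` — §1's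
first theorem over `N24_provisos₁₃SepCoPH_door_theta13OfThm1CCMWZ_of_gauge9TopStepR_of_betaBoxSignFree_allTorus`.  CONDITIONAL on the door letters; nothing of Bałaban asserted;
K0⁷ ∕ K1⁹ NOT closed. [cite: Balaban1985Variational, Thm 1 (8)–(9) p.279, Prop. 8 p.304; Balaban1988Convergent, Thm 1 p.262, (2.6)–(2.8) pp.255–256, (2.21) p.258, (3.16)–(3.23) pp.268–270; Balaban1987RG1, Thm 1 p.255, §1 p.264; Balaban1989LargeFieldI, (0.2)–(0.4) p.176 (bookkeeping)] -/
theorem antecedent_gaussPinH_theta13OfThm1CCMWZ_of_gauge9TopStepR_of_betaBoxSignFree_allTorus_door {c : ℕ} (hγ₀ : 0 < γ) (hγh : γ ≤ 1 / 2)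
    (hε : 0 < ε₀) (hε' : 0 < ε₂₉) (hB : 0 ≤ B₃) (hB' : 0 ≤ B₃') (ha₀ : 0 < a₀) (ha₁ : 0 < a₁)
    (h15 : VariationalThm1RegSepCoP7M F N B₃ a₀ a₁) (hc : c ≤ F.L ^ j)
    (h9 : Gauge9RegSepTopStepR F N (fun ν K Ω => suppDomOfRecord F ν K Ω) (F.L ^ j) c B₃ B₃' a₀ a₁)
    {bl β' : ℝ} (hbox : BetaLowerH bl γ (betaOfRecord₁₃ F N (theta13OfThm1CCMWZ F N j γ ε₀ ε₂₉ B₃ B₃' a₀ a₁ Efl logz)))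
    (hbox' : BetaUpperH β' γ (betaOfRecord₁₃ F N (theta13OfThm1CCMWZ F N j γ ε₀ ε₂₉ B₃ B₃' a₀ a₁ Efl logz))) (hl : -bl * γ ^ 2 ≤ 3) (hβ' : β' * γ ^ 2 ≤ 3 / 4) :
    (gaussPinH (Stage13HParams.ofHistoryBlind F N ⟨theta13OfThm1CCMWZ F N j γ ε₀ ε₂₉ B₃ B₃' a₀ a₁ Efl logz,
        ZrOfRecord₁₃ F N (theta13OfThm1CCMWZ F N j γ ε₀ ε₂₉ B₃ B₃' a₀ a₁ Efl logz)⟩)).Provisos₁₃SepCoPH F N ∧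
      ((gaussPinH (Stage13HParams.ofHistoryBlind F N ⟨theta13OfThm1CCMWZ F N j γ ε₀ ε₂₉ B₃ B₃' a₀ a₁ Efl logz,
          ZrOfRecord₁₃ F N (theta13OfThm1CCMWZ F N j γ ε₀ ε₂₉ B₃ B₃' a₀ a₁ Efl logz)⟩)).ZhUnity F N ∧
        (gaussPinH (Stage13HParams.ofHistoryBlind F N ⟨theta13OfThm1CCMWZ F N j γ ε₀ ε₂₉ B₃ B₃' a₀ a₁ Efl logz,
          ZrOfRecord₁₃ F N (theta13OfThm1CCMWZ F N j γ ε₀ ε₂₉ B₃ B₃' a₀ a₁ Efl logz)⟩)).SlotsNondegenerate₁₃ F N) ∧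
      (gaussPinH (Stage13HParams.ofHistoryBlind F N ⟨theta13OfThm1CCMWZ F N j γ ε₀ ε₂₉ B₃ B₃' a₀ a₁ Efl logz,
        ZrOfRecord₁₃ F N (theta13OfThm1CCMWZ F N j γ ε₀ ε₂₉ B₃ B₃' a₀ a₁ Efl logz)⟩)).Admissible F N :=
  antecedent_gaussPinH_ofHistoryBlind_theta13OfThm1CCMWZ hγ₀ hγh hε hε' hB hB' ha₀ ha₁ _
    (N24_provisos₁₃SepCoPH_door_theta13OfThm1CCMWZ_of_gauge9TopStepR_of_betaBoxSignFree_allTorus hγ₀ hγh hε hε' hB hB' ha₀ ha₁ h15 hc h9 hbox hbox' hl hβ')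

/-- **★★ The door provisos at `θᴳᶻ` alone** (the `hP` slot of dag-n24-c's `N24_nodesAtSomeRecord13PWSVW_byName_atWitness` at `θ := θᴳᶻ`), keyed on the Z door letters.
[cite: Balaban1988Convergent, Thm 1 p.262, (3.16)–(3.22) pp.268–269; Balaban1985Variational, Thm 1 (8)–(9) p.279 (bookkeeping)] -/
theorem provisos₁₃SepCoPH_gaussPinH_theta13OfThm1CCMWZ_door {c : ℕ} (hγ₀ : 0 < γ) (hγh : γ ≤ 1 / 2)
    (hε : 0 < ε₀) (hε' : 0 < ε₂₉) (hB : 0 ≤ B₃) (hB' : 0 ≤ B₃') (ha₀ : 0 < a₀) (ha₁ : 0 < a₁)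
    (h15 : VariationalThm1RegSepCoP7M F N B₃ a₀ a₁) (hc : c ≤ F.L ^ j)
    (h9 : Gauge9RegSepTopStepR F N (fun ν K Ω => suppDomOfRecord F ν K Ω) (F.L ^ j) c B₃ B₃' a₀ a₁)
    {bl β' : ℝ} (hbox : BetaLowerH bl γ (betaOfRecord₁₃ F N (theta13OfThm1CCMWZ F N j γ ε₀ ε₂₉ B₃ B₃' a₀ a₁ Efl logz)))
    (hbox' : BetaUpperH β' γ (betaOfRecord₁₃ F N (theta13OfThm1CCMWZ F N j γ ε₀ ε₂₉ B₃ B₃' a₀ a₁ Efl logz))) (hl : -bl * γ ^ 2 ≤ 3) (hβ' : β' * γ ^ 2 ≤ 3 / 4) :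
    (gaussPinH (Stage13HParams.ofHistoryBlind F N ⟨theta13OfThm1CCMWZ F N j γ ε₀ ε₂₉ B₃ B₃' a₀ a₁ Efl logz,
        ZrOfRecord₁₃ F N (theta13OfThm1CCMWZ F N j γ ε₀ ε₂₉ B₃ B₃' a₀ a₁ Efl logz)⟩)).Provisos₁₃SepCoPH F N :=
  (antecedent_gaussPinH_theta13OfThm1CCMWZ_of_gauge9TopStepR_of_betaBoxSignFree_allTorus_door hγ₀ hγh hε hε' hB hB' ha₀ ha₁ h15 hc h9 hbox hbox' hl hβ').1

/-- **★ The unity ∧ non-degeneracy guard at `θᴳᶻ` — UNCONDITIONAL** (the `hU` slot at `θ := θᴳᶻ`; general `Zr`; letters NOT read).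
[cite: Balaban1988Convergent, (1.11) p.248, (3.16)–(3.22) pp.268–269; Balaban1989LargeFieldI, (0.2)–(0.3) p.176 (bookkeeping)] -/
theorem zhUnity_slotsNondegenerate₁₃_gaussPinH_ofHistoryBlind_theta13OfThm1CCMWZ (Zr : (q : B12.RunParams) → TkResidualW F N (FluctV N) q.K) :
    (gaussPinH (Stage13HParams.ofHistoryBlind F N ⟨theta13OfThm1CCMWZ F N j γ ε₀ ε₂₉ B₃ B₃' a₀ a₁ Efl logz, Zr⟩)).ZhUnity F N ∧
      (gaussPinH (Stage13HParams.ofHistoryBlind F N ⟨theta13OfThm1CCMWZ F N j γ ε₀ ε₂₉ B₃ B₃' a₀ a₁ Efl logz, Zr⟩)).SlotsNondegenerate₁₃ F N :=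
  ⟨zhUnity_of_gaussCert _ (gaussPinH_ζ0 _), slotsNondegenerate₁₃_theta13OfThm1CCMWZ F N j γ ε₀ ε₂₉ B₃ B₃' a₀ a₁ Efl logz⟩

/-- **★ Admissibility at `θᴳᶻ`** from the window + six signs, WHATEVER THE LETTERS (the `hθ` slot at `θ := θᴳᶻ`; general `Zr`).
[cite: Balaban1988Convergent, (2.6)–(2.8) pp.255–256, (2.10) p.256; Balaban1987RG1, Thm 1 p.259; Balaban1989LargeFieldI, (0.4) p.176 (bookkeeping)] -/
theorem admissible_gaussPinH_ofHistoryBlind_theta13OfThm1CCMWZ (hγ₀ : 0 < γ) (hγh : γ ≤ 1 / 2) (hε : 0 < ε₀) (hε' : 0 < ε₂₉) (hB : 0 ≤ B₃) (hB' : 0 ≤ B₃')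
    (ha₀ : 0 < a₀) (ha₁ : 0 < a₁) (Zr : (q : B12.RunParams) → TkResidualW F N (FluctV N) q.K) :
    (gaussPinH (Stage13HParams.ofHistoryBlind F N ⟨theta13OfThm1CCMWZ F N j γ ε₀ ε₂₉ B₃ B₃' a₀ a₁ Efl logz, Zr⟩)).Admissible F N :=
  admissible_theta13OfThm1CCMWZ_of_le_half F N Efl logz hγ₀ hγh hε hε' hB hB' ha₀ ha₁

end Antecedent

/-! ## §2  N13's CoPH 𝐑-leaf and the (R₁₃) law chain at `θᴳᶻ` (the `hlaws` door row) — dag-n24-c's free-slot Z rows read at `θᴳᶻ`'s own slots -/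

section RLeaf

variable {j : ℕ} {γ ε₀ ε₂₉ B₃ B₃' a₀ a₁ : ℝ} {Efl logz : B12.RunParams → ℕ → ℝ} (Zr : (q : B12.RunParams) → TkResidualW F N (FluctV N) q.K) (p : B12.RunParams)

/-- **★ N13's CoPH 𝐑-leaf at `θᴳᶻ`**: `ROpLeaf (VOfRecord₁₃CoPH F N θᴳᶻ p)` from the window `0 < γ ≤ ½` and the six admissibility signs — dag-n24-c's free-slot
`N24_rOpLeaf_VOfRecord₁₃CoPH_theta13OfThm1CCMWZ` at the slots `(Zr, θᴳᶻ.Zh, θᴳᶻ.Phih)` (§0 `…_eq_tuple`).  NO [15] fact, NO `bg`, letters NOT read.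
[cite: Balaban1988Convergent, p.244, (3.16) p.268; Balaban1989LargeFieldI, (0.3)–(0.4) p.176, p.177 (i)–(ii); Balaban1989LargeFieldII, Thm 1 p.355 (not exercised); Balaban1987RG1, Thm 1 p.255, §1 p.264 (window)] -/
theorem N13_rOpLeaf_VOfRecord₁₃CoPH_gaussPinH_ofHistoryBlind_theta13OfThm1CCMWZ (hγ₀ : 0 < γ) (hγh : γ ≤ 1 / 2) (hε : 0 < ε₀) (hε' : 0 < ε₂₉) (hB : 0 ≤ B₃)
    (hB' : 0 ≤ B₃') (ha₀ : 0 < a₀) (ha₁ : 0 < a₁) :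
    ROpLeaf (VOfRecord₁₃CoPH F N (gaussPinH (Stage13HParams.ofHistoryBlind F N ⟨theta13OfThm1CCMWZ F N j γ ε₀ ε₂₉ B₃ B₃' a₀ a₁ Efl logz, Zr⟩)) p) :=
  N24_rOpLeaf_VOfRecord₁₃CoPH_theta13OfThm1CCMWZ Zr
    (gaussPinH (Stage13HParams.ofHistoryBlind F N ⟨theta13OfThm1CCMWZ F N j γ ε₀ ε₂₉ B₃ B₃' a₀ a₁ Efl logz, Zr⟩)).Zh
    (gaussPinH (Stage13HParams.ofHistoryBlind F N ⟨theta13OfThm1CCMWZ F N j γ ε₀ ε₂₉ B₃ B₃' a₀ a₁ Efl logz, Zr⟩)).Phih p hγ₀ hγh hε hε' hB hB' ha₀ ha₁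

/-- **★ N13's (R₁₃) slot in law form at `θᴳᶻ`**: `∀ k < K, TLaw₁₃CoPH θᴳᶻ p k → SLaw₁₃CoPH θᴳᶻ p (k+1)` from the window and the six signs (dag-n24-c's free-slot
`N24_laws₁₃CoPH_theta13OfThm1CCMWZ` at `θᴳᶻ`'s slots). [cite: Balaban1988Convergent, p.244 (bookkeeping); Balaban1989LargeFieldI, (0.3)–(0.4) p.176; Balaban1989LargeFieldII, Thm 1 p.355 (not exercised)] -/
theorem N13_laws₁₃CoPH_gaussPinH_ofHistoryBlind_theta13OfThm1CCMWZ (hγ₀ : 0 < γ) (hγh : γ ≤ 1 / 2) (hε : 0 < ε₀) (hε' : 0 < ε₂₉) (hB : 0 ≤ B₃) (hB' : 0 ≤ B₃')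
    (ha₀ : 0 < a₀) (ha₁ : 0 < a₁) :
    ∀ k, k < p.K →
      TLaw₁₃CoPH F N (gaussPinH (Stage13HParams.ofHistoryBlind F N ⟨theta13OfThm1CCMWZ F N j γ ε₀ ε₂₉ B₃ B₃' a₀ a₁ Efl logz, Zr⟩)) p k →
        SLaw₁₃CoPH F N (gaussPinH (Stage13HParams.ofHistoryBlind F N ⟨theta13OfThm1CCMWZ F N j γ ε₀ ε₂₉ B₃ B₃' a₀ a₁ Efl logz, Zr⟩)) p (k + 1) :=
  N24_laws₁₃CoPH_theta13OfThm1CCMWZ Zr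
    (gaussPinH (Stage13HParams.ofHistoryBlind F N ⟨theta13OfThm1CCMWZ F N j γ ε₀ ε₂₉ B₃ B₃' a₀ a₁ Efl logz, Zr⟩)).Zh
    (gaussPinH (Stage13HParams.ofHistoryBlind F N ⟨theta13OfThm1CCMWZ F N j γ ε₀ ε₂₉ B₃ B₃' a₀ a₁ Efl logz, Zr⟩)).Phih p hγ₀ hγh hε hε' hB hB' ha₀ ha₁

/-- **★★ N13's (R₁₃) slot at `θᴳᶻ` for ALL runs at once** — the literal `hlaws` door-row shape `∀ P k, k < P.K → TLaw → SLaw (k+1)` of dag-n24-c's `…_byName_atWitness` at `θ := θᴳᶻ`.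
[cite: Balaban1988Convergent, p.244 (bookkeeping); Balaban1989LargeFieldII, Thm 1 p.355 (not exercised)] -/
theorem N13_laws₁₃CoPH_all_gaussPinH_ofHistoryBlind_theta13OfThm1CCMWZ (hγ₀ : 0 < γ) (hγh : γ ≤ 1 / 2) (hε : 0 < ε₀) (hε' : 0 < ε₂₉) (hB : 0 ≤ B₃)
    (hB' : 0 ≤ B₃') (ha₀ : 0 < a₀) (ha₁ : 0 < a₁) :
    ∀ (P : B12.RunParams) (k : ℕ), k < P.K →
      TLaw₁₃CoPH F N (gaussPinH (Stage13HParams.ofHistoryBlind F N ⟨theta13OfThm1CCMWZ F N j γ ε₀ ε₂₉ B₃ B₃' a₀ a₁ Efl logz, Zr⟩)) P k →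
        SLaw₁₃CoPH F N (gaussPinH (Stage13HParams.ofHistoryBlind F N ⟨theta13OfThm1CCMWZ F N j γ ε₀ ε₂₉ B₃ B₃' a₀ a₁ Efl logz, Zr⟩)) P (k + 1) :=
  fun P => N13_laws₁₃CoPH_gaussPinH_ofHistoryBlind_theta13OfThm1CCMWZ Zr P hγ₀ hγh hε hε' hB hB' ha₀ ha₁

end RLeaf

/-! ## §3  N11's ALL-RUNS `hT` binder, Theorem 1 and the `h11` TYPE at `θᴳᶻ` — from `hrec` + a token per run, resp. `SupplierObligations` + `OperandRowsAlongChain`, nothing else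
(`θᴳᶻ.toStage13Params = θ₁₅ᶜᶜᴹᵂᶻ = (theta13OfNumericsZ …).liveRepin₁₃`, `rfl`; the WINDOWED editions are this seat's `…TokensAtZWitness` §3) -/

section N11Side

variable {j : ℕ} {γ ε₀ ε₂₉ B₃ B₃' a₀ a₁ : ℝ} {Efl logz : B12.RunParams → ℕ → ℝ} (Zr : (q : B12.RunParams) → TkResidualW F N (FluctV N) q.K)

/-- **★★ N11's ALL-RUNS `hT` BINDER AT `θᴳᶻ` FROM A TOKEN PER RUN**: `∀ P k, k < P.K → SLaw₁₃CoPH θᴳᶻ P k → TLaw₁₃CoPH θᴳᶻ P k` from `hrec` (the door core) and N11's one-token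
residual `∀ P, SupplyChainAt θᴳᶻ P` (this seat's θ-generic `thmP245Laws_all_liveRepinH_of_supplyChainAt` at `θ₀ := theta13OfNumericsZ …`, Z2's `admissible_theta13OfNumericsZ`; numerals
`κ = 2·10⁴`, `E₀ = B₀ = 1`, `M = L^j ≥ 1`).  CONDITIONAL; N11 NOT discharged. [cite: Balaban1988Convergent, Theorem p.245, Thm 1 p.262, remark p.262, §3 p.279, (3.23)–(3.25) p.270, (1.15) p.249; Balaban1987RG1, Thm 1 p.259; Balaban1989LargeFieldII, (0.15) p.360; Balaban1989LargeFieldI, (0.2)–(0.4) p.176] -/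
theorem hT_gaussPinH_ofHistoryBlind_theta13OfThm1CCMWZ_of_supplyChainAt (hγ₀ : 0 < γ) (hγh : γ ≤ 1 / 2) (hε : 0 < ε₀) (hε' : 0 < ε₂₉)
    (hB : 0 ≤ B₃) (hB' : 0 ≤ B₃') (ha₀ : 0 < a₀) (ha₁ : 0 < a₁)
    (hrec : (gaussPinH (Stage13HParams.ofHistoryBlind F N ⟨theta13OfThm1CCMWZ F N j γ ε₀ ε₂₉ B₃ B₃' a₀ a₁ Efl logz, Zr⟩)).Provisos₁₃CoPH F N)
    (hN : ∀ P : B12.RunParams, SupplyChainAt (gaussPinH (Stage13HParams.ofHistoryBlind F N ⟨theta13OfThm1CCMWZ F N j γ ε₀ ε₂₉ B₃ B₃' a₀ a₁ Efl logz, Zr⟩)) P) :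
    ∀ (P : B12.RunParams) (k : ℕ), k < P.K →
      SLaw₁₃CoPH F N (gaussPinH (Stage13HParams.ofHistoryBlind F N ⟨theta13OfThm1CCMWZ F N j γ ε₀ ε₂₉ B₃ B₃' a₀ a₁ Efl logz, Zr⟩)) P k →
        TLaw₁₃CoPH F N (gaussPinH (Stage13HParams.ofHistoryBlind F N ⟨theta13OfThm1CCMWZ F N j γ ε₀ ε₂₉ B₃ B₃' a₀ a₁ Efl logz, Zr⟩)) P k :=
  thmP245Laws_all_liveRepinH_of_supplyChainAt (θ := gaussPinH (Stage13HParams.ofHistoryBlind F N ⟨theta13OfThm1CCMWZ F N j γ ε₀ ε₂₉ B₃ B₃' a₀ a₁ Efl logz, Zr⟩))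
    (θ₀ := theta13OfNumericsZ F N (stage12NumericsOfThm1CCMW F.L j γ ε₀ B₃ B₃' a₀ a₁) ε₂₉
      (zeta316OfRecord F N (stage12NumericsOfThm1CCMW F.L j γ ε₀ B₃ B₃' a₀ a₁).ν (stage12NumericsOfThm1CCMW F.L j γ ε₀ B₃ B₃' a₀ a₁).τ9.M
        (stage12NumericsOfThm1CCMW F.L j γ ε₀ B₃ B₃' a₀ a₁).A₁) (RzOfRecord F N) (ZtOfRecord F N) Efl logz)
    rfl (admissible_theta13OfNumericsZ F N _ _ _ Efl logz (stage12NumericsOfThm1CCMW_pos_of_le_half F.hL.2.le hγ₀ hγh hε hB hB' ha₀ ha₁) hε')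
    (by rw [theta13OfNumericsZ_s2, show (stage12NumericsOfThm1CCMW F.L j γ ε₀ B₃ B₃' a₀ a₁).s2.lf.κ = 20000 from rfl]; norm_num)
    (by rw [theta13OfNumericsZ_s2, show (stage12NumericsOfThm1CCMW F.L j γ ε₀ B₃ B₃' a₀ a₁).s2.lf.E₀ = 1 from rfl]; norm_num)
    (by rw [theta13OfNumericsZ_s2, show (stage12NumericsOfThm1CCMW F.L j γ ε₀ B₃ B₃' a₀ a₁).s2.lf.B₀ = 1 from rfl]; norm_num)
    (one_le_M_stage12NumericsOfThm1CCMW F j γ ε₀ B₃ B₃' a₀ a₁) hrec hN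

/-- **★★★ N11's ALL-RUNS `hT` BINDER AT `θᴳᶻ` FROM `hrec` + `SupplierObligations` + `OperandRowsAlongChain`** — the no-expansion half of `SupplyChainAt` DISCHARGED in the
Gaussian-certificate class (dag-n11-e's `noExpansionObligation_of_gaussCert_of_operandRows`; the keys `gaussPinH_ζ0 ∕ _quad` are `rfl`), per run; window + six signs; letters NOT read.
dag-n11-w6 §2's `hT_…` at the z-witness.  CONDITIONAL; N11 NOT discharged; K1⁹ NOT closed. [cite: Balaban1988Convergent, Theorem p.245, Thm 1 p.262, remark p.262, §3 p.279, (3.16)–(3.25) pp.268–270, (2.21) p.258, (1.15) p.249; Balaban1987RG1, Thm 1 p.259; Balaban1989LargeFieldII, (0.15) p.360; Balaban1989LargeFieldI, (0.2)–(0.4) p.176] -/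
theorem hT_gaussPinH_ofHistoryBlind_theta13OfThm1CCMWZ_of_obligations_of_operandRows (hγ₀ : 0 < γ) (hγh : γ ≤ 1 / 2) (hε : 0 < ε₀) (hε' : 0 < ε₂₉)
    (hB : 0 ≤ B₃) (hB' : 0 ≤ B₃') (ha₀ : 0 < a₀) (ha₁ : 0 < a₁)
    (hrec : (gaussPinH (Stage13HParams.ofHistoryBlind F N ⟨theta13OfThm1CCMWZ F N j γ ε₀ ε₂₉ B₃ B₃' a₀ a₁ Efl logz, Zr⟩)).Provisos₁₃CoPH F N)
    (σ : (P : B12.RunParams) → Sect3Supplier (gaussPinH (Stage13HParams.ofHistoryBlind F N ⟨theta13OfThm1CCMWZ F N j γ ε₀ ε₂₉ B₃ B₃' a₀ a₁ Efl logz, Zr⟩)) P)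
    (hσ : ∀ P, SupplierObligations (gaussPinH (Stage13HParams.ofHistoryBlind F N ⟨theta13OfThm1CCMWZ F N j γ ε₀ ε₂₉ B₃ B₃' a₀ a₁ Efl logz, Zr⟩)) P (σ P))
    (hops : ∀ P, OperandRowsAlongChain (gaussPinH (Stage13HParams.ofHistoryBlind F N ⟨theta13OfThm1CCMWZ F N j γ ε₀ ε₂₉ B₃ B₃' a₀ a₁ Efl logz, Zr⟩)) P (σ P)) :
    ∀ (P : B12.RunParams) (k : ℕ), k < P.K →
      SLaw₁₃CoPH F N (gaussPinH (Stage13HParams.ofHistoryBlind F N ⟨theta13OfThm1CCMWZ F N j γ ε₀ ε₂₉ B₃ B₃' a₀ a₁ Efl logz, Zr⟩)) P k →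
        TLaw₁₃CoPH F N (gaussPinH (Stage13HParams.ofHistoryBlind F N ⟨theta13OfThm1CCMWZ F N j γ ε₀ ε₂₉ B₃ B₃' a₀ a₁ Efl logz, Zr⟩)) P k :=
  hT_gaussPinH_ofHistoryBlind_theta13OfThm1CCMWZ_of_supplyChainAt Zr hγ₀ hγh hε hε' hB hB' ha₀ ha₁ hrec fun P =>
    ⟨σ P, hσ P, noExpansionObligation_of_gaussCert_of_operandRows (gaussPinH_ζ0 _) (gaussPinH_quad _) hrec
      (one_le_M_stage12NumericsOfThm1CCMW F j γ ε₀ B₃ B₃' a₀ a₁) (σ P) (hσ P).loc (hops P)⟩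

/-- **★★ THEOREM 1 OF [III], ALL LEVELS `k ≤ K`, AT `θᴳᶻ`** from `hrec` + a supplier with its obligations + def-T's operand rows (this seat's θ-generic
`sLaw₁₃CoPH_all_liveRepinH_gaussCert_of_obligations_of_operandRows` at `θ₀ := theta13OfNumericsZ …`).  CONDITIONAL; letters NOT read. [cite: Balaban1988Convergent, Thm 1 p.262, Theorem p.245, (3.16)–(3.25) pp.268–270, (2.21) p.258, (1.11) p.248, (1.15) p.249; Balaban1987RG1, Thm 1 p.259; Balaban1989LargeFieldII, (0.15) p.360; Balaban1989LargeFieldI, (0.2)–(0.4) p.176] -/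
theorem sLaw₁₃CoPH_all_gaussPinH_ofHistoryBlind_theta13OfThm1CCMWZ_of_obligations_of_operandRows {p : B12.RunParams} (hγ₀ : 0 < γ) (hγh : γ ≤ 1 / 2)
    (hε : 0 < ε₀) (hε' : 0 < ε₂₉) (hB : 0 ≤ B₃) (hB' : 0 ≤ B₃') (ha₀ : 0 < a₀) (ha₁ : 0 < a₁)
    (hrec : (gaussPinH (Stage13HParams.ofHistoryBlind F N ⟨theta13OfThm1CCMWZ F N j γ ε₀ ε₂₉ B₃ B₃' a₀ a₁ Efl logz, Zr⟩)).Provisos₁₃CoPH F N)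
    (σ : Sect3Supplier (gaussPinH (Stage13HParams.ofHistoryBlind F N ⟨theta13OfThm1CCMWZ F N j γ ε₀ ε₂₉ B₃ B₃' a₀ a₁ Efl logz, Zr⟩)) p)
    (hσ : SupplierObligations (gaussPinH (Stage13HParams.ofHistoryBlind F N ⟨theta13OfThm1CCMWZ F N j γ ε₀ ε₂₉ B₃ B₃' a₀ a₁ Efl logz, Zr⟩)) p σ)
    (hops : OperandRowsAlongChain (gaussPinH (Stage13HParams.ofHistoryBlind F N ⟨theta13OfThm1CCMWZ F N j γ ε₀ ε₂₉ B₃ B₃' a₀ a₁ Efl logz, Zr⟩)) p σ) :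
    ∀ k, k ≤ p.K → SLaw₁₃CoPH F N (gaussPinH (Stage13HParams.ofHistoryBlind F N ⟨theta13OfThm1CCMWZ F N j γ ε₀ ε₂₉ B₃ B₃' a₀ a₁ Efl logz, Zr⟩)) p k :=
  sLaw₁₃CoPH_all_liveRepinH_gaussCert_of_obligations_of_operandRows (θ := gaussPinH (Stage13HParams.ofHistoryBlind F N ⟨theta13OfThm1CCMWZ F N j γ ε₀ ε₂₉ B₃ B₃' a₀ a₁ Efl logz, Zr⟩))
    (θ₀ := theta13OfNumericsZ F N (stage12NumericsOfThm1CCMW F.L j γ ε₀ B₃ B₃' a₀ a₁) ε₂₉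
      (zeta316OfRecord F N (stage12NumericsOfThm1CCMW F.L j γ ε₀ B₃ B₃' a₀ a₁).ν (stage12NumericsOfThm1CCMW F.L j γ ε₀ B₃ B₃' a₀ a₁).τ9.M
        (stage12NumericsOfThm1CCMW F.L j γ ε₀ B₃ B₃' a₀ a₁).A₁) (RzOfRecord F N) (ZtOfRecord F N) Efl logz)
    rfl (admissible_theta13OfNumericsZ F N _ _ _ Efl logz (stage12NumericsOfThm1CCMW_pos_of_le_half F.hL.2.le hγ₀ hγh hε hB hB' ha₀ ha₁) hε')
    (by rw [theta13OfNumericsZ_s2, show (stage12NumericsOfThm1CCMW F.L j γ ε₀ B₃ B₃' a₀ a₁).s2.lf.κ = 20000 from rfl]; norm_num)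
    (by rw [theta13OfNumericsZ_s2, show (stage12NumericsOfThm1CCMW F.L j γ ε₀ B₃ B₃' a₀ a₁).s2.lf.E₀ = 1 from rfl]; norm_num)
    (by rw [theta13OfNumericsZ_s2, show (stage12NumericsOfThm1CCMW F.L j γ ε₀ B₃ B₃' a₀ a₁).s2.lf.B₀ = 1 from rfl]; norm_num)
    (one_le_M_stage12NumericsOfThm1CCMW F j γ ε₀ B₃ B₃' a₀ a₁) (gaussPinH_ζ0 _) (gaussPinH_quad _) hrec σ hσ hops

/-- **N11's TYPE `h11` AT `θᴳᶻ`'s SepCoPH DATUM IN dag-n24-c's `…_byName_atWitness` SHAPE FROM THE ALL-RUNS `hT` BINDER** (the world, its letters `(βup, β₀, γ)` and the leaf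
antecedents are NOT read — `γ₁₁ := 1`; ANY door proof `hG` keys the datum; dag-n11-w6 §2's packaging at the z-witness).  CONDITIONAL on `hT`; N11 NOT discharged.
[cite: Balaban1988Convergent, Theorem p.245, Thm 1 p.262, remark p.262, (3.24)–(3.25) p.270; Balaban1989LargeFieldII, Thm 1 p.355 (bookkeeping)] -/
theorem N11_h11_gaussPinH_ofHistoryBlind_theta13OfThm1CCMWZ_of_laws
    (hG : (gaussPinH (Stage13HParams.ofHistoryBlind F N ⟨theta13OfThm1CCMWZ F N j γ ε₀ ε₂₉ B₃ B₃' a₀ a₁ Efl logz, Zr⟩)).Provisos₁₃SepCoPH F N)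
    (hT : ∀ (P : B12.RunParams) (k : ℕ), k < P.K →
      SLaw₁₃CoPH F N (gaussPinH (Stage13HParams.ofHistoryBlind F N ⟨theta13OfThm1CCMWZ F N j γ ε₀ ε₂₉ B₃ B₃' a₀ a₁ Efl logz, Zr⟩)) P k →
        TLaw₁₃CoPH F N (gaussPinH (Stage13HParams.ofHistoryBlind F N ⟨theta13OfThm1CCMWZ F N j γ ε₀ ε₂₉ B₃ B₃' a₀ a₁ Efl logz, Zr⟩)) P k) :
    ∀ βup β₀ : ℝ, ∃ γ₁₁ : ℝ, 0 < γ₁₁ ∧ ∀ w : WorldP,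
      w.C = (datumOfRecord₁₃SepCoPH F N (gaussPinH (Stage13HParams.ofHistoryBlind F N ⟨theta13OfThm1CCMWZ F N j γ ε₀ ε₂₉ B₃ B₃' a₀ a₁ Efl logz, Zr⟩)) hG).C →
      w.βup = βup → w.β₀ = β₀ → w.γ ≤ γ₁₁ → ∀ P : B12.RunParams, (leavesP w P).b7 → (leavesP w P).b8 → (leavesP w P).b9 → (leavesP w P).b10 → (leavesP w P).b11 →
      (leavesP w P).smallCouplings → (leavesP w P).smallFieldInductive → (leavesP w P).flowControl →
        ∀ k, k < P.K → SLaw₁₃CoPH F N (gaussPinH (Stage13HParams.ofHistoryBlind F N ⟨theta13OfThm1CCMWZ F N j γ ε₀ ε₂₉ B₃ B₃' a₀ a₁ Efl logz, Zr⟩)) P k →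
          TLaw₁₃CoPH F N (gaussPinH (Stage13HParams.ofHistoryBlind F N ⟨theta13OfThm1CCMWZ F N j γ ε₀ ε₂₉ B₃ B₃' a₀ a₁ Efl logz, Zr⟩)) P k :=
  fun _ _ => ⟨1, one_pos, fun _ _ _ _ _ P _ _ _ _ _ _ _ _ k hk hS => hT P k hk hS⟩

/-- **★★★ N11's TYPE `h11` AT `θᴳᶻ`'s SepCoPH DATUM FROM `hrec` + `SupplierObligations` + `OperandRowsAlongChain`** (the supplier for the switch `θᴴᶻ ↦ θᴳᶻ` of a K1 Z closer's N11
binder: §3's `hT` through the previous theorem; general `Zr`, any door proof `hG`).  CONDITIONAL; N11 NOT discharged; K1⁹ NOT closed. [cite: Balaban1988Convergent, Theorem p.245, Thm 1 p.262, remark p.262, §3 p.279, (3.23)–(3.25) p.270, (2.21) p.258, (1.15) p.249; Balaban1987RG1, Thm 1 p.259; Balaban1989LargeFieldI, (0.2)–(0.4) p.176; Balaban1989LargeFieldII, Thm 1 p.355, (0.15) p.360 (bookkeeping)] -/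
theorem N11_h11_gaussPinH_ofHistoryBlind_theta13OfThm1CCMWZ_of_obligations_of_operandRows (hγ₀ : 0 < γ) (hγh : γ ≤ 1 / 2) (hε : 0 < ε₀) (hε' : 0 < ε₂₉)
    (hB : 0 ≤ B₃) (hB' : 0 ≤ B₃') (ha₀ : 0 < a₀) (ha₁ : 0 < a₁)
    (hG : (gaussPinH (Stage13HParams.ofHistoryBlind F N ⟨theta13OfThm1CCMWZ F N j γ ε₀ ε₂₉ B₃ B₃' a₀ a₁ Efl logz, Zr⟩)).Provisos₁₃SepCoPH F N)
    (σ : (P : B12.RunParams) → Sect3Supplier (gaussPinH (Stage13HParams.ofHistoryBlind F N ⟨theta13OfThm1CCMWZ F N j γ ε₀ ε₂₉ B₃ B₃' a₀ a₁ Efl logz, Zr⟩)) P)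
    (hσ : ∀ P, SupplierObligations (gaussPinH (Stage13HParams.ofHistoryBlind F N ⟨theta13OfThm1CCMWZ F N j γ ε₀ ε₂₉ B₃ B₃' a₀ a₁ Efl logz, Zr⟩)) P (σ P))
    (hops : ∀ P, OperandRowsAlongChain (gaussPinH (Stage13HParams.ofHistoryBlind F N ⟨theta13OfThm1CCMWZ F N j γ ε₀ ε₂₉ B₃ B₃' a₀ a₁ Efl logz, Zr⟩)) P (σ P)) :
    ∀ βup β₀ : ℝ, ∃ γ₁₁ : ℝ, 0 < γ₁₁ ∧ ∀ w : WorldP,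
      w.C = (datumOfRecord₁₃SepCoPH F N (gaussPinH (Stage13HParams.ofHistoryBlind F N ⟨theta13OfThm1CCMWZ F N j γ ε₀ ε₂₉ B₃ B₃' a₀ a₁ Efl logz, Zr⟩)) hG).C →
      w.βup = βup → w.β₀ = β₀ → w.γ ≤ γ₁₁ → ∀ P : B12.RunParams, (leavesP w P).b7 → (leavesP w P).b8 → (leavesP w P).b9 → (leavesP w P).b10 → (leavesP w P).b11 →
      (leavesP w P).smallCouplings → (leavesP w P).smallFieldInductive → (leavesP w P).flowControl →
        ∀ k, k < P.K → SLaw₁₃CoPH F N (gaussPinH (Stage13HParams.ofHistoryBlind F N ⟨theta13OfThm1CCMWZ F N j γ ε₀ ε₂₉ B₃ B₃' a₀ a₁ Efl logz, Zr⟩)) P k →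
          TLaw₁₃CoPH F N (gaussPinH (Stage13HParams.ofHistoryBlind F N ⟨theta13OfThm1CCMWZ F N j γ ε₀ ε₂₉ B₃ B₃' a₀ a₁ Efl logz, Zr⟩)) P k :=
  N11_h11_gaussPinH_ofHistoryBlind_theta13OfThm1CCMWZ_of_laws Zr hG
    (hT_gaussPinH_ofHistoryBlind_theta13OfThm1CCMWZ_of_obligations_of_operandRows Zr hγ₀ hγh hε hε' hB hB' ha₀ ha₁ hG.toCore σ hσ hops)

end N11Side

end Summit.QuantumFields.YangMills.Theorems.BalabanUVNodesN11K1WitnessGaussPinHAtZ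

end
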